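import Summits.QuantumFields.BalabanUV.Beta.GAN24.Capacitance

/-!
# `BalabanUV.Beta.GAN24.ZeroAliasPinning` — binder row G-an2-4 / (CONV-C), road P1-fibre (toward p1's L10, (U1)): THE ZERO-ALIAS PINNING LEMMA —
# N-uniform injectivity of the enlarged capacitance system near `p = 0` from SCALED smallness of six blocks (abstract; no fibre objects)

NOT IN PRINT; OUR PROOF ATTEMPT.  HONEST FRAMING (cell contract, verbatim): «discharging `BetaPertH` makes Bałaban's UV stability UNCONDITIONAL — a real
constructive-QFT result; it is NOT the continuum limit and NOT the Clay problem.»  HONEST DEPENDENCY (verbatim): «continuum YM on T⁴ ⇐ BetaPertH ∧ nine spine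
estimates (0/9 proved); BetaPertH ⇐ (D1) ∧ (D4) ∧ CAP+tail; G-an2-4 gates asym, D1 and NE2/3/4.»  [folklore] finite-dimensional linear algebra with norms over `ℂ`
(no cited fact, no wall binder, no `def`).  NOT summit progress; nothing of (CONV-C)'s K-slot is discharged here.

## The lemma
Abstract data: good-fibre data `F : CapacitanceSolve.Fibre D ι` (only its capacitance sums `capP/capV/capW` enter) and zero-alias data `L0, dd0, db0 : symbols`,
`wE0, wG0, wQ0, wM0 : border weights`.  THE HOMOGENEOUS ENLARGED SYSTEM (the four row families of `EnlargedCapacitance.EnlSolves` at zero sources, with the good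
aliases already summed by leaf-15's `sum_wQ_Ablk`/`sum_wM_mublk`):
  (E) `2(L0·A0_κ − dd0_κ (db0·A0)) − L0 dd0_κ μ0 − wE0_κ φ_κ = 0`,  (G) `L0 (db0·A0) − wG0 c = 0`,
  (Q) `wQ0_κ A0_κ + (capP F φ)_κ + capV F κ · c = 0`,               (M) `wM0 μ0 − Σ_κ capW F κ φ_κ = 0`.
**`pinning`**: if `‖L0‖ ≤ ℓ`, `‖dd0_κ‖ ≤ δ₁`, `‖db0_κ‖ ≤ δ₂`, the pinning weights are bounded BELOW (`e ≤ ‖wE0_κ‖`, `g ≤ ‖wG0‖`, `q ≤ ‖wQ0_κ‖`, `m ≤ ‖wM0‖`, all `> 0`)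
and the good capacitance is bounded ABOVE (`Σ_κ ‖capP κ l‖ ≤ P`, `Σ_κ ‖capV κ‖ ≤ V`, `‖capW κ‖ ≤ W`), then under the two SCALED SMALLNESS conditions
`θ_c := ℓ δ₂ V / (g q) < 1` and `Θ := [2(ℓ + Dδ₁δ₂)(P + V·K)/q + D ℓ δ₁ W/m]/e < 1`, `K := ℓ δ₂ P/(g q − ℓ δ₂ V)`, the system has ONLY THE TRIVIAL SOLUTION.
N-UNIFORMITY (why this is the right lemma for (U1) near p = 0, |Im p| ≤ κ): with the fibre scalings `ℓ ~ |p|²/N²`, `δᵢ ~ |p|/N`, `e ~ N`, `g ~ 1`, `q ~ N^{D+1}`, `m ~ N^D`,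
`P ~ N^{D+4}|p|²`, `V, W ~ N^{D+4}|p|³` every power of N CANCELS in `θ_c ~ |p|⁶`, `K ~ |p|⁵`, `Θ ~ |p|⁴`: injectivity for `|p| ≤ r₀(D)` uniformly in N — the
endpoint/cone region of L10.  (The fibre bounds themselves are L06/Y08s-type alias sums at complex momenta; not here.)
Also: `pinning_enl` — the same read on the rows BEFORE summation (hypotheses in `Σ_m wQ·Ablk F 0 0 φ c` / `Σ_m wM·mublk F 0 φ` form, as `EnlSolves … 0 0 0 0 0 0` unfolds).
Unit `b2b-balaban-gan24-formalise-leaf-06` (G-an2-4 formalisation swarm), 2026-08-20.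
-/

noncomputable section

open Complex Finset
open scoped BigOperators
open Summit.QuantumFields.BalabanUV.Beta.GAN24.FibreBlockSolve (dot)
open Summit.QuantumFields.BalabanUV.Beta.GAN24.CapacitanceSolve (Fibre capP capV capW srcQ srcM Ablk mublk sum_wQ_Ablk sum_wM_mublk)
open Summit.QuantumFields.BalabanUV.Beta.GAN24.Capacitance (srcQ_zero srcM_zero)

namespace Summit.QuantumFields.BalabanUV.Beta.GAN24.ZeroAliasPinning

variable {D : ℕ} {ι : Type*} [Fintype ι] (F : Fibre D ι)

/-- [folklore] `‖u·v‖ ≤ δ · Σ_κ ‖v_κ‖` when every `‖u_κ‖ ≤ δ`. -/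
theorem norm_dot_le {u v : Fin D → ℂ} {δ : ℝ} (hu : ∀ κ, ‖u κ‖ ≤ δ) : ‖dot u v‖ ≤ δ * ∑ κ, ‖v κ‖ := by
  unfold dot
  calc ‖∑ κ, u κ * v κ‖ ≤ ∑ κ, ‖u κ * v κ‖ := norm_sum_le _ _
    _ ≤ ∑ κ, δ * ‖v κ‖ := Finset.sum_le_sum fun κ _ => by
        rw [norm_mul]; exact mul_le_mul_of_nonneg_right (hu κ) (norm_nonneg _)
    _ = δ * ∑ κ, ‖v κ‖ := by rw [Finset.mul_sum]

/-- [folklore] A nonnegative real `x` with `x ≤ Θ·x`, `Θ < 1`, vanishes. -/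
theorem eq_zero_of_le_mul_self {x Θ : ℝ} (hx : 0 ≤ x) (hΘ : Θ < 1) (h : x ≤ Θ * x) : x = 0 := by
  nlinarith

/-- [folklore] **THE ZERO-ALIAS PINNING LEMMA** (abstract rows; see the module docstring for the scalings that make it N-uniform). -/
theorem pinning {L0 wG0 wM0 : ℂ} {dd0 db0 wE0 wQ0 : Fin D → ℂ}
    {ℓ δ₁ δ₂ e g q m P V W : ℝ}
    (hℓ : ‖L0‖ ≤ ℓ) (hd1 : ∀ κ, ‖dd0 κ‖ ≤ δ₁) (hd2 : ∀ κ, ‖db0 κ‖ ≤ δ₂)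
    (he : 0 < e) (hE : ∀ κ, e ≤ ‖wE0 κ‖) (hg : 0 < g) (hG : g ≤ ‖wG0‖) (hq : 0 < q) (hQ : ∀ κ, q ≤ ‖wQ0 κ‖) (hm : 0 < m) (hM : m ≤ ‖wM0‖)
    (hP : ∀ l, ∑ κ, ‖capP F κ l‖ ≤ P) (hV : ∑ κ, ‖capV F κ‖ ≤ V) (hW : ∀ κ, ‖capW F κ‖ ≤ W)
    (hℓ0 : 0 ≤ ℓ) (hδ1 : 0 ≤ δ₁) (hδ2 : 0 ≤ δ₂) (hP0 : 0 ≤ P) (hV0 : 0 ≤ V)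
    (hθ : ℓ * δ₂ * V < g * q)
    (hΘ : (2 * (ℓ + D * δ₁ * δ₂) * (P + V * (ℓ * δ₂ * P / (g * q - ℓ * δ₂ * V))) / q + D * ℓ * δ₁ * W / m) / e < 1)
    {A0 : Fin D → ℂ} {μ0 : ℂ} {φ : Fin D → ℂ} {c : ℂ}
    (hErow : ∀ κ, 2 * (L0 * A0 κ - dd0 κ * dot db0 A0) - L0 * dd0 κ * μ0 - wE0 κ * φ κ = 0)
    (hGrow : L0 * dot db0 A0 - wG0 * c = 0)
    (hQrow : ∀ κ, wQ0 κ * A0 κ + (∑ l, capP F κ l * φ l + capV F κ * c) = 0)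
    (hMrow : wM0 * μ0 - ∑ κ, capW F κ * φ κ = 0) :
    A0 = 0 ∧ μ0 = 0 ∧ φ = 0 ∧ c = 0 := by
  -- ℓ¹ sizes
  set nA : ℝ := ∑ κ, ‖A0 κ‖ with hnA
  set nφ : ℝ := ∑ κ, ‖φ κ‖ with hnφ
  have hnA0 : 0 ≤ nA := Finset.sum_nonneg fun κ _ => norm_nonneg _
  have hnφ0 : 0 ≤ nφ := Finset.sum_nonneg fun κ _ => norm_nonneg _
  have hdot : ‖dot db0 A0‖ ≤ δ₂ * nA := norm_dot_le hd2
  -- (G): ‖c‖ ≤ ℓ δ₂ nA / g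
  have hc : ‖c‖ ≤ ℓ * δ₂ * nA / g := by
    have h1 : wG0 * c = L0 * dot db0 A0 := by linear_combination -hGrow
    have h2 : g * ‖c‖ ≤ ‖L0‖ * ‖dot db0 A0‖ := by
      calc g * ‖c‖ ≤ ‖wG0‖ * ‖c‖ := mul_le_mul_of_nonneg_right hG (norm_nonneg _)
        _ = ‖L0 * dot db0 A0‖ := by rw [← norm_mul, h1]
        _ = ‖L0‖ * ‖dot db0 A0‖ := norm_mul _ _
    rw [le_div_iff₀ hg]
    calc ‖c‖ * g = g * ‖c‖ := mul_comm _ _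
      _ ≤ ‖L0‖ * ‖dot db0 A0‖ := h2
      _ ≤ ℓ * (δ₂ * nA) := mul_le_mul hℓ hdot (norm_nonneg _) hℓ0
      _ = ℓ * δ₂ * nA := by ring
  -- (M): ‖μ0‖ ≤ W nφ / m
  have hμ : ‖μ0‖ ≤ W * nφ / m := by
    have h1 : wM0 * μ0 = ∑ κ, capW F κ * φ κ := by linear_combination hMrow
    have h2 : ‖∑ κ, capW F κ * φ κ‖ ≤ W * nφ := by
      calc ‖∑ κ, capW F κ * φ κ‖ ≤ ∑ κ, ‖capW F κ * φ κ‖ := norm_sum_le _ _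
        _ ≤ ∑ κ, W * ‖φ κ‖ := Finset.sum_le_sum fun κ _ => by
            rw [norm_mul]; exact mul_le_mul_of_nonneg_right (hW κ) (norm_nonneg _)
        _ = W * nφ := by rw [Finset.mul_sum]
    rw [le_div_iff₀ hm]
    calc ‖μ0‖ * m = m * ‖μ0‖ := mul_comm _ _
      _ ≤ ‖wM0‖ * ‖μ0‖ := mul_le_mul_of_nonneg_right hM (norm_nonneg _)
      _ = ‖∑ κ, capW F κ * φ κ‖ := by rw [← norm_mul, h1]
      _ ≤ W * nφ := h2
  -- (Q): nA ≤ (P nφ + V ‖c‖)/q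
  have hA : nA ≤ (P * nφ + V * ‖c‖) / q := by
    have hκ : ∀ κ, q * ‖A0 κ‖ ≤ ∑ l, ‖capP F κ l‖ * ‖φ l‖ + ‖capV F κ‖ * ‖c‖ := by
      intro κ
      have h1 : wQ0 κ * A0 κ = -(∑ l, capP F κ l * φ l + capV F κ * c) := by linear_combination hQrow κ
      calc q * ‖A0 κ‖ ≤ ‖wQ0 κ‖ * ‖A0 κ‖ := mul_le_mul_of_nonneg_right (hQ κ) (norm_nonneg _)
        _ = ‖∑ l, capP F κ l * φ l + capV F κ * c‖ := by rw [← norm_mul, h1, norm_neg]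
        _ ≤ ‖∑ l, capP F κ l * φ l‖ + ‖capV F κ * c‖ := norm_add_le _ _
        _ ≤ ∑ l, ‖capP F κ l * φ l‖ + ‖capV F κ * c‖ := by gcongr; exact norm_sum_le _ _
        _ = ∑ l, ‖capP F κ l‖ * ‖φ l‖ + ‖capV F κ‖ * ‖c‖ := by simp only [norm_mul]
    have hsum : q * nA ≤ P * nφ + V * ‖c‖ := by
      calc q * nA = ∑ κ, q * ‖A0 κ‖ := by rw [Finset.mul_sum]
        _ ≤ ∑ κ, (∑ l, ‖capP F κ l‖ * ‖φ l‖ + ‖capV F κ‖ * ‖c‖) := Finset.sum_le_sum fun κ _ => hκ κ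
        _ = ∑ l, (∑ κ, ‖capP F κ l‖) * ‖φ l‖ + (∑ κ, ‖capV F κ‖) * ‖c‖ := by
            rw [Finset.sum_add_distrib, Finset.sum_mul, Finset.sum_comm]
            congr 1
            exact Finset.sum_congr rfl fun l _ => by rw [Finset.sum_mul]
        _ ≤ ∑ l, P * ‖φ l‖ + V * ‖c‖ := by
            gcongr with l
            · exact hP l
        _ = P * nφ + V * ‖c‖ := by rw [Finset.mul_sum]
    rw [le_div_iff₀ hq]; linarith
  -- (E): nφ ≤ [2(ℓ + D δ₁ δ₂) nA + D ℓ δ₁ ‖μ0‖]/e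
  have hφ : nφ ≤ (2 * (ℓ + D * δ₁ * δ₂) * nA + D * ℓ * δ₁ * ‖μ0‖) / e := by
    have hκ : ∀ κ, e * ‖φ κ‖ ≤ 2 * (ℓ * ‖A0 κ‖ + δ₁ * (δ₂ * nA)) + ℓ * δ₁ * ‖μ0‖ := by
      intro κ
      have h1 : wE0 κ * φ κ = 2 * (L0 * A0 κ - dd0 κ * dot db0 A0) - L0 * dd0 κ * μ0 := by linear_combination -hErow κ
      calc e * ‖φ κ‖ ≤ ‖wE0 κ‖ * ‖φ κ‖ := mul_le_mul_of_nonneg_right (hE κ) (norm_nonneg _)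
        _ = ‖2 * (L0 * A0 κ - dd0 κ * dot db0 A0) - L0 * dd0 κ * μ0‖ := by rw [← norm_mul, h1]
        _ ≤ ‖2 * (L0 * A0 κ - dd0 κ * dot db0 A0)‖ + ‖L0 * dd0 κ * μ0‖ := norm_sub_le _ _
        _ ≤ 2 * (‖L0‖ * ‖A0 κ‖ + ‖dd0 κ‖ * ‖dot db0 A0‖) + ‖L0‖ * ‖dd0 κ‖ * ‖μ0‖ := by
            rw [norm_mul, norm_mul, norm_mul, Complex.norm_two]
            gcongr
            calc ‖L0 * A0 κ - dd0 κ * dot db0 A0‖ ≤ ‖L0 * A0 κ‖ + ‖dd0 κ * dot db0 A0‖ := norm_sub_le _ _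
              _ = ‖L0‖ * ‖A0 κ‖ + ‖dd0 κ‖ * ‖dot db0 A0‖ := by rw [norm_mul, norm_mul]
        _ ≤ 2 * (ℓ * ‖A0 κ‖ + δ₁ * (δ₂ * nA)) + ℓ * δ₁ * ‖μ0‖ := by
            gcongr
            · exact hd1 κ
            · exact hd1 κ
    have hsum : e * nφ ≤ 2 * (ℓ + D * δ₁ * δ₂) * nA + D * ℓ * δ₁ * ‖μ0‖ := by
      calc e * nφ = ∑ κ, e * ‖φ κ‖ := by rw [Finset.mul_sum]
        _ ≤ ∑ κ, (2 * (ℓ * ‖A0 κ‖ + δ₁ * (δ₂ * nA)) + ℓ * δ₁ * ‖μ0‖) := Finset.sum_le_sum fun κ _ => hκ κ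
        _ = 2 * (ℓ * nA + D * (δ₁ * (δ₂ * nA))) + D * (ℓ * δ₁ * ‖μ0‖) := by
            rw [Finset.sum_add_distrib, Finset.sum_const, Finset.card_univ, Fintype.card_fin, nsmul_eq_mul, ← Finset.mul_sum,
              Finset.sum_add_distrib, ← Finset.mul_sum, Finset.sum_const, Finset.card_univ, Fintype.card_fin, nsmul_eq_mul]
        _ = 2 * (ℓ + D * δ₁ * δ₂) * nA + D * ℓ * δ₁ * ‖μ0‖ := by ring
    rw [le_div_iff₀ he]; linarith
  -- close the loop: ‖c‖ ≤ K nφ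
  have hgq : 0 < g * q - ℓ * δ₂ * V := by linarith
  have hcK : ‖c‖ ≤ ℓ * δ₂ * P / (g * q - ℓ * δ₂ * V) * nφ := by
    -- from hc and hA: g ‖c‖ ≤ ℓ δ₂ nA ≤ ℓ δ₂ (P nφ + V‖c‖)/q
    have h1 : g * q * ‖c‖ ≤ ℓ * δ₂ * (P * nφ + V * ‖c‖) := by
      have h2 : g * ‖c‖ ≤ ℓ * δ₂ * nA := by rw [le_div_iff₀ hg] at hc; linarith
      have h3 : q * nA ≤ P * nφ + V * ‖c‖ := by rw [le_div_iff₀ hq] at hA; linarith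
      have h4 : 0 ≤ ℓ * δ₂ := mul_nonneg hℓ0 hδ2
      nlinarith
    rw [div_mul_eq_mul_div, le_div_iff₀ hgq]
    nlinarith
  -- nφ ≤ Θ nφ
  have hK0 : 0 ≤ ℓ * δ₂ * P / (g * q - ℓ * δ₂ * V) := div_nonneg (by positivity) hgq.le
  have hloop : nφ ≤ ((2 * (ℓ + D * δ₁ * δ₂) * (P + V * (ℓ * δ₂ * P / (g * q - ℓ * δ₂ * V))) / q + D * ℓ * δ₁ * W / m) / e) * nφ := by
    set K : ℝ := ℓ * δ₂ * P / (g * q - ℓ * δ₂ * V) with hKdef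
    have hA' : nA ≤ (P + V * K) / q * nφ := by
      rw [div_mul_eq_mul_div, le_div_iff₀ hq]
      rw [le_div_iff₀ hq] at hA
      have : V * ‖c‖ ≤ V * (K * nφ) := mul_le_mul_of_nonneg_left hcK hV0
      calc nA * q ≤ P * nφ + V * ‖c‖ := hA
        _ ≤ P * nφ + V * (K * nφ) := by linarith
        _ = (P + V * K) * nφ := by ring
    have hμ' : ‖μ0‖ ≤ W / m * nφ := by rw [div_mul_eq_mul_div]; exact hμ
    rw [le_div_iff₀ he] at hφ
    rw [div_mul_eq_mul_div, le_div_iff₀ he]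
    have h5 : 0 ≤ 2 * (ℓ + D * δ₁ * δ₂) := by positivity
    have h6 : 0 ≤ (D : ℝ) * ℓ * δ₁ := by positivity
    have h7 := mul_le_mul_of_nonneg_left hA' h5
    have h8 := mul_le_mul_of_nonneg_left hμ' h6
    calc nφ * e ≤ 2 * (ℓ + D * δ₁ * δ₂) * nA + D * ℓ * δ₁ * ‖μ0‖ := hφ
      _ ≤ 2 * (ℓ + D * δ₁ * δ₂) * ((P + V * K) / q * nφ) + D * ℓ * δ₁ * (W / m * nφ) := add_le_add h7 h8
      _ = (2 * (ℓ + D * δ₁ * δ₂) * (P + V * K) / q + D * ℓ * δ₁ * W / m) * nφ := by ring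
  have hφ0 : nφ = 0 := eq_zero_of_le_mul_self hnφ0 hΘ hloop
  -- unwind
  have hφz : φ = 0 := by
    funext κ
    have : ‖φ κ‖ ≤ nφ := Finset.single_le_sum (fun κ _ => norm_nonneg (φ κ)) (Finset.mem_univ κ)
    rw [hφ0] at this
    exact norm_le_zero_iff.mp this
  have hcz : c = 0 := by
    have : ‖c‖ ≤ 0 := by rw [hφ0, mul_zero] at hcK; exact hcK
    exact norm_le_zero_iff.mp this
  have hAz : A0 = 0 := by
    have hnA' : nA ≤ 0 := by rw [hφ0, hcz, norm_zero, mul_zero, mul_zero, add_zero, zero_div] at hA; exact hA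
    funext κ
    have : ‖A0 κ‖ ≤ nA := Finset.single_le_sum (fun κ _ => norm_nonneg (A0 κ)) (Finset.mem_univ κ)
    exact norm_le_zero_iff.mp (this.trans hnA')
  have hμz : μ0 = 0 := by
    have : ‖μ0‖ ≤ 0 := by rw [hφ0, mul_zero, zero_div] at hμ; exact hμ
    exact norm_le_zero_iff.mp this
  exact ⟨hAz, hμz, hφz, hcz⟩

/-- [folklore] **THE PINNING LEMMA ON THE UNSUMMED ROWS**: the same with the Q/M rows in the form `wQ0_κ A0_κ + Σ_m wQ_{mκ}·Ablk F 0 0 φ c m κ = 0`,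
`wM0 μ0 + Σ_m wM_m·mublk F 0 φ m = 0` (as `EnlargedCapacitance.EnlSolves F z 0 0 0 0 0 0 A0 μ0 φ c` unfolds) — leaf-15's `sum_wQ_Ablk`/`sum_wM_mublk`. -/
theorem pinning_enl {L0 wG0 wM0 : ℂ} {dd0 db0 wE0 wQ0 : Fin D → ℂ}
    {ℓ δ₁ δ₂ e g q m P V W : ℝ}
    (hℓ : ‖L0‖ ≤ ℓ) (hd1 : ∀ κ, ‖dd0 κ‖ ≤ δ₁) (hd2 : ∀ κ, ‖db0 κ‖ ≤ δ₂)
    (he : 0 < e) (hE : ∀ κ, e ≤ ‖wE0 κ‖) (hg : 0 < g) (hG : g ≤ ‖wG0‖) (hq : 0 < q) (hQ : ∀ κ, q ≤ ‖wQ0 κ‖) (hm : 0 < m) (hM : m ≤ ‖wM0‖)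
    (hP : ∀ l, ∑ κ, ‖capP F κ l‖ ≤ P) (hV : ∑ κ, ‖capV F κ‖ ≤ V) (hW : ∀ κ, ‖capW F κ‖ ≤ W)
    (hℓ0 : 0 ≤ ℓ) (hδ1 : 0 ≤ δ₁) (hδ2 : 0 ≤ δ₂) (hP0 : 0 ≤ P) (hV0 : 0 ≤ V)
    (hθ : ℓ * δ₂ * V < g * q)
    (hΘ : (2 * (ℓ + D * δ₁ * δ₂) * (P + V * (ℓ * δ₂ * P / (g * q - ℓ * δ₂ * V))) / q + D * ℓ * δ₁ * W / m) / e < 1)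
    {A0 : Fin D → ℂ} {μ0 : ℂ} {φ : Fin D → ℂ} {c : ℂ}
    (hErow : ∀ κ, 2 * (L0 * A0 κ - dd0 κ * dot db0 A0) - L0 * dd0 κ * μ0 - wE0 κ * φ κ = 0)
    (hGrow : L0 * dot db0 A0 - wG0 * c = 0)
    (hQrow : ∀ κ, wQ0 κ * A0 κ + ∑ i, F.wQ i κ * Ablk F 0 0 φ c i κ = 0)
    (hMrow : wM0 * μ0 + ∑ i, F.wM i * mublk F 0 φ i = 0) :
    A0 = 0 ∧ μ0 = 0 ∧ φ = 0 ∧ c = 0 := by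
  refine pinning F hℓ hd1 hd2 he hE hg hG hq hQ hm hM hP hV hW hℓ0 hδ1 hδ2 hP0 hV0 hθ hΘ hErow hGrow (fun κ => ?_) ?_
  · have h := hQrow κ
    rw [sum_wQ_Ablk, srcQ_zero, zero_add] at h
    exact h
  · have h := hMrow
    rw [sum_wM_mublk, srcM_zero, neg_zero, zero_sub, ← sub_eq_add_neg] at h
    exact h

end Summit.QuantumFields.BalabanUV.Beta.GAN24.ZeroAliasPinning

end
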